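import Mathlib
import HarnessLib
import Summits.HubbardSuperconductivity.HubbardSuperconductivity.Theorems.KLProgrammeC4aLoopWindowDichotomy
import Summits.HubbardSuperconductivity.HubbardSuperconductivity.Theorems.KLProgrammeC4aFarBoxRows
import Summits.HubbardSuperconductivity.HubbardSuperconductivity.Theorems.KLProgrammeC4aMonotoneBoxRows

/-!
# Route `KLProgramme` — crux C4a, S3 brick (B4) «(U1)-LAWS» part 10: the BOX WITHOUT A NEAR-CAUSTIC WITNESS in ONE CALL — dichotomy (part 9) at every `ϑ` of the tile,
# then the far bound (part 7) or the monotone bound (part 8) pointwise, then × `(β − α)`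

Cell `gate-hubbard-kl`, seat hubbard-kl-k3c3-p3 (g32; row «implicit-function / monotonicity route for μ(n)»).  Located brick for the (C)-closer lane / the (M4)
assembly of the umklapp first-order ϑ-layer (stub (C) `stub_twoLeg_curvature` of `KLRegimeEngineV17F2`, stmt-HubbardSuperconductivity-20437), memo
HOME/hubbard-kl-k3c3-p3/U1-CAUSTIC-SUP.md §14.

WHY.  The complement of the near-caustic branch.  At each `ϑ` of the tile `[α,β]` the loop window `[φa,φb]` is far (`|ē(0,·)| ≥ d₁`) or transversal at every loop level
(`|∂_vē| > λ`) by `…C4aLoopWindowDichotomy.loopWindow_far_or_transversal`; the branch may change with `ϑ`, but both pointwise bounds (`…C4aFarBoxRows.farBox_pointwise_le`,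
`…C4aMonotoneBoxRows.monotoneBox_pointwise_le`, called on the degenerate tile `[ϑ,ϑ]`) are `ϑ`-free numbers, so `F(ϑ) ≤ max(b_far, b_mono)` on the tile and
`∫_{α..β} F ≤ (β − α)·max(b_far, b_mono)` — no integrability, no fold structure, no sign condition.
* **`noWitnessBox_integral_le`** (HEADLINE): the hypotheses of part 9 at every `ϑ ∈ [α,β]` (not Cooper; outside the margin of every sheet's caustic at every loop angle),
  `K₁·hi/(Dt−2A) ≤ d₁/2` (part 7), the curvature ceiling `G₂` and the kernel / weight / profile rows of part 8 ⟹
  `∫_{α..β} |∫_{−hi..hi}∫_{φa..φb} w·(X·(K e)′(ē))| dϑ ≤ (β − α)·max(2hi·((φb−φa)·(W·X₀·(4/d₁²))), W·((X₀·(G₂/λ²) + X₁·λ⁻¹)·(λ⁻¹·(4√K₀)))·(4√hi))`.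
Sizes binder shape + `GeomConstants`; nothing asserts (C), K3 or superconductivity.
References: BGM 2003 §7.1 Lemma 7.1 [cite: BenfattoGiulianiMastropietro2003]; FST II CPAM 51 (1998) §3 [cite: FeldmanSalmhoferTrubowitz1998].
-/

noncomputable section

namespace Summit.HubbardSuperconductivity.HubbardSuperconductivity.Theorems.C4a

set_option linter.dupNamespace false -- summit = problem name (single-conjunct summit), D-0017

open Real Set MeasureTheory intervalIntegral
open scoped Interval
open Literature.MathematicalPhysics.QuantumLattice Literature.MathematicalPhysics.QuantumLattice.BandSectorCounting
open Literature.MathematicalPhysics.QuantumLattice.FermiRG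
open Summit.HubbardSuperconductivity.HubbardSuperconductivity.Theorems.KLRegimeSplit
open Summit.HubbardSuperconductivity.HubbardSuperconductivity.Theorems.DispersionFlow
open Summit.HubbardSuperconductivity.HubbardSuperconductivity.Theorems.PerturbedFermiCurve

section Sizes

variable {K : TrigPolyC4v} {A : ℝ} (hA : ∀ p : Momentum, ∀ j ≤ 2, ‖iteratedFDeriv ℝ j (frameShift K) p‖ ≤ A) (hA20 : A ≤ 1 / 20)
  (hd : klCurveD ≤ (bandBounds (show (-4 : ℝ) < -1.1 by norm_num) (show (-1.1 : ℝ) ≤ -0.1 by norm_num)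
    (show (-0.1 : ℝ) < 0 by norm_num)).Dtmin - 2 * A)
  {μ r : ℝ} (hr : 0 < r) (hlo : (-1.1 : ℝ) < μ - r - A) (hhi : μ + r + A < -0.1)
  {A₃ A₄ : ℝ} (hA₃ : ∀ p : Momentum, ‖iteratedFDeriv ℝ 3 (frameShift K) p‖ ≤ A₃)
  (hA₄ : ∀ p : Momentum, ‖iteratedFDeriv ℝ 4 (frameShift K) p‖ ≤ A₄)
  {K₁ : ℝ} (hK₁ : ∀ p : Momentum, ‖fderiv ℝ (frameLevel μ K) p‖ ≤ K₁)
include hA hA20 hd hr hlo hhi hA₃ hA₄ hK₁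

set_option maxHeartbeats 400000 in
/-- **THE BOX WITHOUT A NEAR-CAUSTIC WITNESS** (HEADLINE; see the module docstring). -/
theorem noWitnessBox_integral_le {Kc r₀ g₀ w : ℝ} (hG : GeomConstants (frameLevel μ K) Kc r₀ g₀ w) (ρ θ : ℝ)
    {α β φa φb d₁ lo hi lam eps G₂ X₀ X₁ K₀ W : ℝ} {Kr X : ℝ → ℝ → ℝ} {wt : ℝ → ℝ}
    (hαβ : α ≤ β) (hφ : φa ≤ φb) (hlo0 : 0 < lo) (hlohi : lo ≤ hi) (hhir : hi < r) (hhir₀ : hi < r₀) (hhiK : hi ≤ K₀) (hd₁ : 0 < d₁) (hlam : 0 < lam)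
    (hG₂ : 0 ≤ G₂) (hX₀ : 0 ≤ X₀) (hX₁ : 0 ≤ X₁)
    (hhid : K₁ * (hi / ((bandBounds (show (-4 : ℝ) < -1.1 by norm_num) (show (-1.1 : ℝ) ≤ -0.1 by norm_num) (show (-0.1 : ℝ) < 0 by norm_num)).Dtmin - 2 * A)) ≤ d₁ / 2)
    (heps : d₁ + K₁ * (msD A₃ A₄ 1 * (φb - φa)) + K₁ * (hi / ((bandBounds (show (-4 : ℝ) < -1.1 by norm_num) (show (-1.1 : ℝ) ≤ -0.1 by norm_num) (show (-0.1 : ℝ) < 0 by norm_num)).Dtmin - 2 * A)) + hi ≤ eps) (hepsr : eps ≤ r)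
    (hC : ∀ ϑ ∈ Icc α β, ∀ m : Fin 2 → ℤ, msD A₃ A₄ 1 *
            ((π / 2 * lam /
                  (((bandBounds (show (-4 : ℝ) < -1.1 by norm_num) (show (-1.1 : ℝ) ≤ -0.1 by norm_num) (show (-0.1 : ℝ) < 0 by norm_num)).Dtmin -
                      2 * A) *
                    (bandBounds (show (-4 : ℝ) < -1.1 by norm_num) (show (-1.1 : ℝ) ≤ -0.1 by norm_num) (show (-0.1 : ℝ) < 0 by norm_num)).umin) +
                π * Kc * eps / ((bandBounds (show (-4 : ℝ) < -1.1 by norm_num) (show (-1.1 : ℝ) ≤ -0.1 by norm_num)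
                  (show (-0.1 : ℝ) < 0 by norm_num)).Dtmin - 2 * A) ^ 2) /
              ((bandBounds (show (-4 : ℝ) < -1.1 by norm_num) (show (-1.1 : ℝ) ≤ -0.1 by norm_num) (show (-0.1 : ℝ) < 0 by norm_num)).umin * w /
                (4 + 2 * A))) +
          eps / ((bandBounds (show (-4 : ℝ) < -1.1 by norm_num) (show (-1.1 : ℝ) ≤ -0.1 by norm_num) (show (-0.1 : ℝ) < 0 by norm_num)).Dtmin - 2 * A) <
        ‖pairSumPath μ K ρ ϑ θ 0 - WithLp.toLp 2 (fun i => 2 * π * (m i : ℝ))‖)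
    (hT : ∀ ϑ ∈ Icc α β, ∀ v ∈ Icc φa φb, ∀ m : Fin 2 → ℤ, msD A₃ A₄ 1 *
            ((π / 2 * lam /
                  (((bandBounds (show (-4 : ℝ) < -1.1 by norm_num) (show (-1.1 : ℝ) ≤ -0.1 by norm_num) (show (-0.1 : ℝ) < 0 by norm_num)).Dtmin -
                      2 * A) *
                    (bandBounds (show (-4 : ℝ) < -1.1 by norm_num) (show (-1.1 : ℝ) ≤ -0.1 by norm_num) (show (-0.1 : ℝ) < 0 by norm_num)).umin) +
                π * Kc * eps / ((bandBounds (show (-4 : ℝ) < -1.1 by norm_num) (show (-1.1 : ℝ) ≤ -0.1 by norm_num)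
                  (show (-0.1 : ℝ) < 0 by norm_num)).Dtmin - 2 * A) ^ 2) /
              ((bandBounds (show (-4 : ℝ) < -1.1 by norm_num) (show (-1.1 : ℝ) ≤ -0.1 by norm_num) (show (-0.1 : ℝ) < 0 by norm_num)).umin * w /
                (4 + 2 * A))) +
          (2 * hi + eps) / ((bandBounds (show (-4 : ℝ) < -1.1 by norm_num) (show (-1.1 : ℝ) ≤ -0.1 by norm_num) (show (-0.1 : ℝ) < 0 by norm_num)).Dtmin -
            2 * A) <
        ‖pairSumPath μ K ρ ϑ θ 0 - WithLp.toLp 2 (fun i => 2 * π * (m i : ℝ)) - (2 : ℝ) • levelPoint μ K 0 (v + θ)‖)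
    (hK₀ : ∀ p : Momentum, |frameLevel μ K p| ≤ K₀)
    (hcurv : ∀ ϑ ∈ Icc α β, ∀ e ∈ Icc (-hi) hi, ∀ v ∈ Icc φa φb,
      |iteratedDeriv 2 (fun x : ℝ => frameLevel μ K (pairSumPath μ K ρ ϑ θ 0 - levelPoint μ K e (x + θ))) v| ≤ G₂)
    (hXd : ∀ e ∈ Icc (-hi) hi, ContDiff ℝ 1 (X e)) (hXs : ∀ e ∈ Icc (-hi) hi, tsupport (X e) ⊆ Ioo φa φb)
    (hX2 : ContinuousOn (fun p : ℝ × ℝ => X p.1 p.2) (Icc (-hi) hi ×ˢ univ))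
    (hXb : ∀ e ∈ Icc (-hi) hi, ∀ v, |X e v| ≤ X₀) (hX₁b : ∀ e ∈ Icc (-hi) hi, ∀ v ∈ Ioo φa φb, |deriv (X e) v| ≤ X₁)
    (hKd : ∀ e ∈ Icc (-hi) hi, ContDiff ℝ 1 (Kr e)) (hKc : Continuous fun p : ℝ × ℝ => deriv (Kr p.1) p.2)
    (hK0 : ∀ e ∈ Icc (-hi) hi, e ≠ 0 → ∀ u, |Kr e u| ≤ (max |e| |u|)⁻¹) (hK0s : ∀ e ∈ Icc (-lo) lo, ∀ u, |Kr e u| ≤ (max lo |u|)⁻¹)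
    (hK1 : ∀ e ∈ Icc (-hi) hi, e ≠ 0 → ∀ u, |deriv (Kr e) u| ≤ (max |e| |u|)⁻¹ ^ 2)
    (hKs1 : ∀ e ∈ Icc (-lo) lo, ∀ u, |deriv (Kr e) u| ≤ (max lo |u|)⁻¹ ^ 2)
    (hwc : ContinuousOn wt (Icc (-hi) hi)) (hw0 : ∀ e ∈ Icc (-hi) hi, 0 ≤ wt e) (hwW : ∀ e ∈ Icc (-hi) hi, wt e ≤ W) :
    ∫ ϑ in α..β, |∫ e in (-hi)..hi, ∫ v in φa..φb, wt e * (X e v * deriv (Kr e) (frameLevel μ K (pairSumPath μ K ρ ϑ θ 0 - levelPoint μ K e (v + θ))))| ≤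
      (β - α) * max (2 * hi * ((φb - φa) * (W * X₀ * (4 / d₁ ^ 2))))
        (W * ((X₀ * (G₂ / lam ^ 2) + X₁ * lam⁻¹) * (lam⁻¹ * (4 * Real.sqrt K₀))) * (4 * Real.sqrt hi)) := by
  have hhi0 : 0 ≤ hi := hlo0.le.trans hlohi
  set bfar : ℝ := 2 * hi * ((φb - φa) * (W * X₀ * (4 / d₁ ^ 2))) with hbfar
  set bmono : ℝ := W * ((X₀ * (G₂ / lam ^ 2) + X₁ * lam⁻¹) * (lam⁻¹ * (4 * Real.sqrt K₀))) * (4 * Real.sqrt hi) with hbmono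
  have hpt : ∀ ϑ ∈ Ι α β, ‖|∫ e in (-hi)..hi, ∫ v in φa..φb, wt e * (X e v * deriv (Kr e) (frameLevel μ K (pairSumPath μ K ρ ϑ θ 0 - levelPoint μ K e (v + θ))))|‖ ≤ max bfar bmono := fun ϑ hϑ => by
    rw [uIoc_of_le hαβ] at hϑ
    have hϑI : ϑ ∈ Icc α β := Ioc_subset_Icc_self hϑ
    have hϑϑ : ϑ ∈ Icc ϑ ϑ := ⟨le_rfl, le_rfl⟩
    rw [Real.norm_eq_abs, abs_abs]
    rcases loopWindow_far_or_transversal hA hA20 hd hr hlo hhi hA₃ hA₄ hK₁ hG ρ ϑ θ hhi0 hhir hhir₀ heps hepsr (hC ϑ hϑI) (hT ϑ hϑI) with hfar | htr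
    · refine le_trans ?_ (le_max_left _ _)
      exact farBox_pointwise_le hA hd hr hlo hhi hK₁ ρ θ (α := ϑ) (β := ϑ) hφ hlo0 hhi0 hhir hd₁ hhid (fun ϑ' hϑ' v hv => by
        rw [show ϑ' = ϑ from le_antisymm hϑ'.2 hϑ'.1]; exact hfar v hv) hK1 hKs1 (fun e he v _ => hXb e he v) hw0 hwW hϑϑ
    · refine le_trans ?_ (le_max_right _ _)
      exact monotoneBox_pointwise_le hA hd hlo hhi ρ θ (α := ϑ) (β := ϑ) hφ hlo0 hlohi hhir hhiK hlam hG₂ hX₀ hX₁ hK₀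
        (fun ϑ' hϑ' e he v hv => by rw [show ϑ' = ϑ from le_antisymm hϑ'.2 hϑ'.1]; exact (htr e he v hv).le)
        (fun ϑ' hϑ' e he v hv => by rw [show ϑ' = ϑ from le_antisymm hϑ'.2 hϑ'.1]; exact hcurv ϑ hϑI e he v hv)
        hXd hXs hX2 (fun e he v _ => hXb e he v) hX₁b hKd hKc hK0 hK0s hwc hw0 hwW hϑϑ
  have h := intervalIntegral.norm_integral_le_of_norm_le_const hpt
  rw [Real.norm_eq_abs, abs_of_nonneg (sub_nonneg.2 hαβ)] at h
  refine (le_abs_self _).trans (h.trans (le_of_eq ?_))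
  ring

end Sizes

end Summit.HubbardSuperconductivity.HubbardSuperconductivity.Theorems.C4a

end
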